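import Summits.Ventures.YMGap.RobustBall.RobustAreaLawPairW
import Summits.Ventures.YMGap.RobustBall.AreaLawRowsPair
import Summits.Ventures.YMGap.RobustBall.AreaLawRadius
import HarnessLib

/-!
# Venture YMGap, track Y2 ROBUST-BALL — AREA-LAW RADIUS FUNCTIONS through the pair slab door: a positive ball radius at EVERY coupling of the
# window for EVERY `SU(N)` (hypothesis-free), and the `SU(3)` certified-pair rows read on whole coupling INTERVALS

HONEST FRAMING.  Venture file of the cell `pub-ymgap` (QuantumFields programme), seat engine-2 (g7).  Strong-coupling LATTICE statements only
(`RobustBall.AreaLawOnBall N d β ε₀ ε₁ r mv`: Wilson's area law for rectangular loops on the tori `(ℤ/L)^d`, constants uniform in `L` and over the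
tier-1 ball `ClusterDomainFR ε₀ ε₁ r ∩ IsSlabLocal mv`); nothing about the continuum, a mass gap, weak coupling, or Clay.  Two bookkeeping facts
that the grid rows of §5 leave implicit:

1. **Every `N ≥ 2`, every `d = n + 1`, HYPOTHESIS-FREE — a closed-form radius.**  ds-4's all-`N` pair schema `suN_areaLawOnBall_bakryEmery`
   (engine-2's Holley–Stroock pair door on the tree's Bakry–Émery pair) has the row condition `e^{ε₀} q + e^{ε₀/2} ε₁/√(N D) < 1`,
   `q = R/D`, `R = 2n|β_tH|`, `D = 1/2 − R`; on the window `R < 1/4` (`q < 1`) the one-parameter ball of radius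
   `ε = (1 − q)/4 = (1 − 4R)/(4(1 − 2R))` satisfies it (`e^{x} ≤ 1 + x + x²` on `[0,1]`, `√(N D) ≥ 2/3`):
   `suN_areaLawOnBall_radius : AreaLawOnBall N (n+1) (N β_tH) (2ε) ε r mv` — a POSITIVE radius at EVERY coupling of the window, vanishing linearly
   at its end `R = 1/4` ('t Hooft `|β_tH| < 1/(8n)`; `SU(2)` Wilson `β_W < 1/(2n)`, `SU(3)` Wilson `β_W < 3/(8n)`), for every `N` at once.  It is
   deliberately lossy (`ε(0) = 1/4` against the grid cell `0.64`); the point is «every coupling, every N», complementing rb-p2's `SU(2)` radius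
   function `su2_areaLawOnBall_radius` (quarter modulus, window `nβ_W < 2`).
2. **`SU(3)`, `d = 4`, the certified-pair rows on INTERVALS.**  The rational certificate of the pair-door row schemas `su3_hsRow4` / `su3_hsRow4'`
   (`AreaLawRowsPair`) is monotone in `β_W`, so each grid row holds on the whole interval below its coupling: GIVEN H1/H2 (P11),
   `0 ≤ β_W ≤ 1/4 ⇒ ε = 0.381`, `≤ 1/2 ⇒ 0.230`, `≤ 11/20 ⇒ 0.205`; GIVEN H1/H2′ (P35), `0 ≤ β_W ≤ 3/4 ⇒ 0.064`, `≤ 4/5 ⇒ 0.043` — i.e. the `SU(3)`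
   area-law ball has radius `≥ 0.205` at every `β_W ≤ 11/20` and `≥ 0.043` at every `β_W ≤ 4/5` (conditional classes as in `AreaLawRowsPair`;
   NOTHING asserted about H1 `OneLinkPoincareSUN 3 (3/5) (4/5)`, H2 `OneLinkVarianceBound 3 (11/30) (49/20)`, H2′ `OneLinkVarianceBound 3 (3/5) (17/5)`).
-/

noncomputable section

open MeasureTheory ProbabilityTheory Real
open Literature.MathematicalPhysics.QuantumFieldTheory
open Summit.QuantumFields.BalabanUV.InfraRed.StrongCouplingPoincareDoorSUN (OneLinkPoincareSUN)
open Summit.QuantumFields.BalabanUV.InfraRed.StrongCouplingVarianceDoorSUN (OneLinkVarianceBound)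
open Summit.Ventures.YMGap.RobustBall (AreaLawOnBall AreaLawOnBall.anti suN_areaLawOnBall_bakryEmery)

namespace Summit.Ventures.YMGap.RobustBallPair

variable {N n : ℕ}

/-! ### 1. Every `N ≥ 2`: a positive radius at every coupling of the Bakry–Émery pair window -/

/-- `e^{x} ≤ 1 + x + x²` for `0 ≤ x ≤ 1` (Mathlib `Real.abs_exp_sub_one_sub_id_le`). [folklore] -/
theorem exp_le_one_add_add_sq {x : ℝ} (h0 : 0 ≤ x) (h1 : x ≤ 1) : exp x ≤ 1 + x + x ^ 2 := by
  have h := Real.abs_exp_sub_one_sub_id_le (x := x) (by rwa [abs_of_nonneg h0])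
  have := (abs_le.1 h).2
  linarith

/-- **The radius certificate.**  For `0 ≤ R < 1/4`, `X ≥ 4/9` and `ε = (1 − 4R)/(4(1 − 2R))` (`= (1 − q)/4`, `q = R/(1/2 − R)`):
`e^{2ε} R/(1/2 − R) + e^{2ε/2} ε/√X < 1`.  Proof: `q = 1 − δ`, `ε = δ/4`, `e^{x} ≤ 1 + x + x²`, `1/√X ≤ 3/2`, and
`(1 + δ/2 + δ²/4)(1 − δ) + (3/2)(1 + δ/4 + δ²/16)(δ/4) = 1 − δ/8 − (5/32)δ² − (29/128)δ³ < 1`. [folklore] -/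
theorem bePair_radius_cert {R X : ℝ} (hR0 : 0 ≤ R) (hR : R < 1 / 4) (hX : 4 / 9 ≤ X) :
    exp (2 * ((1 - 4 * R) / (4 * (1 - 2 * R)))) * R / (1 / 2 - R) +
      exp (2 * ((1 - 4 * R) / (4 * (1 - 2 * R))) / 2) * ((1 - 4 * R) / (4 * (1 - 2 * R))) / Real.sqrt X < 1 := by
  set δ : ℝ := (1 - 4 * R) / (1 - 2 * R) with hδdef
  have hD : 0 < 1 - 2 * R := by linarith
  have hDne : (1 - 2 * R) ≠ 0 := hD.ne'
  have hD2ne : (1 / 2 - R) ≠ 0 := by intro h; apply hDne; linarith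
  have hδ0 : 0 < δ := by rw [hδdef]; exact div_pos (by linarith) hD
  have hδ1 : δ ≤ 1 := by rw [hδdef, div_le_one hD]; linarith
  have hε : (1 - 4 * R) / (4 * (1 - 2 * R)) = δ / 4 := by
    rw [hδdef]; field_simp
  have hq : R / (1 / 2 - R) = 1 - δ := by
    have e : (1 / 2 - R) = (1 - 2 * R) / 2 := by ring
    rw [hδdef, e, div_div_eq_mul_div, eq_sub_iff_add_eq, ← add_div, div_eq_one_iff_eq hDne]
    ring
  have e1 : exp (2 * (δ / 4)) * R / (1 / 2 - R) = exp (δ / 2) * (1 - δ) := by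
    rw [show 2 * (δ / 4) = δ / 2 by ring, mul_div_assoc, hq]
  have e2 : exp (2 * (δ / 4) / 2) * (δ / 4) / Real.sqrt X = exp (δ / 4) * (δ / 4) / Real.sqrt X := by
    rw [show 2 * (δ / 4) / 2 = δ / 4 by ring]
  rw [hε, e1, e2]
  have hE2 := exp_le_one_add_add_sq (x := δ / 2) (by linarith) (by linarith)
  have hE1 := exp_le_one_add_add_sq (x := δ / 4) (by linarith) (by linarith)
  have hXs : 2 / 3 ≤ Real.sqrt X := by
    rw [show (2 / 3 : ℝ) = Real.sqrt ((2 / 3) ^ 2) by rw [Real.sqrt_sq (by norm_num)]]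
    exact Real.sqrt_le_sqrt (by linarith)
  have hXpos : 0 < Real.sqrt X := lt_of_lt_of_le (by norm_num) hXs
  have h2 : exp (δ / 4) * (δ / 4) / Real.sqrt X ≤ (1 + δ / 4 + (δ / 4) ^ 2) * (δ / 4) * (3 / 2) := by
    rw [div_le_iff₀ hXpos]
    calc exp (δ / 4) * (δ / 4) ≤ (1 + δ / 4 + (δ / 4) ^ 2) * (δ / 4) := mul_le_mul_of_nonneg_right hE1 (by linarith)
      _ = (1 + δ / 4 + (δ / 4) ^ 2) * (δ / 4) * (3 / 2) * (2 / 3) := by ring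
      _ ≤ (1 + δ / 4 + (δ / 4) ^ 2) * (δ / 4) * (3 / 2) * Real.sqrt X :=
          mul_le_mul_of_nonneg_left hXs (by positivity)
  have h1 : exp (δ / 2) * (1 - δ) ≤ (1 + δ / 2 + (δ / 2) ^ 2) * (1 - δ) := mul_le_mul_of_nonneg_right hE2 (by linarith)
  have hpoly : (1 + δ / 2 + (δ / 2) ^ 2) * (1 - δ) + (1 + δ / 4 + (δ / 4) ^ 2) * (δ / 4) * (3 / 2) < 1 := by
    nlinarith [pow_pos hδ0 2, pow_pos hδ0 3]
  linarith

/-- **EVERY `N ≥ 2`, every `d = n + 1`, HYPOTHESIS-FREE — A POSITIVE AREA-LAW RADIUS AT EVERY COUPLING OF THE WINDOW.**  With `R = 2n|β_tH| < 1/4`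
('t Hooft coupling `β_tH`, tree coupling `N β_tH`) and `ε = (1 − 4R)/(4(1 − 2R)) > 0`:  `AreaLawOnBall N (n+1) (N β_tH) (2ε) ε r mv` for every range `r`
and vertical window `mv ≥ 1` — the pair slab door on the tree's Bakry–Émery pair (ds-4's `suN_areaLawOnBall_bakryEmery`), with the radius
certificate `bePair_radius_cert` (`N D ≥ 4/9` since `N ≥ 2`, `D > 1/4`).  The radius vanishes linearly at the end of the window `R = 1/4`.
[cite: arXiv220412737, Lemma 4.1 and Rem. 1.3] -/
theorem suN_areaLawOnBall_radius (hN : 2 ≤ N) {βt : ℝ} (hb : |βt| * (2 * (n : ℝ)) < 1 / 4) (r : ℕ) {mv : ℕ} (hmv : 1 ≤ mv) :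
    AreaLawOnBall N (n + 1) ((N : ℝ) * βt)
      (2 * ((1 - 4 * (|βt| * (2 * (n : ℝ)))) / (4 * (1 - 2 * (|βt| * (2 * (n : ℝ)))))))
      ((1 - 4 * (|βt| * (2 * (n : ℝ)))) / (4 * (1 - 2 * (|βt| * (2 * (n : ℝ)))))) r mv := by
  set R : ℝ := |βt| * (2 * (n : ℝ)) with hRdef
  have hR0 : 0 ≤ R := by positivity
  have hε0 : 0 ≤ (1 - 4 * R) / (4 * (1 - 2 * R)) := div_nonneg (by linarith) (by linarith)
  have hN2 : (2 : ℝ) ≤ N := by exact_mod_cast hN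
  have hX : 4 / 9 ≤ (N : ℝ) * (1 / 2 - R) := by nlinarith
  refine suN_areaLawOnBall_bakryEmery (n := n) hN hε0 (by linarith) r hmv ?_
  exact bePair_radius_cert hR0 hb hX

/-- The `SU(2)`, `d = 4` reading in Wilson units (`β_tH = β_W/4`, `R = 3β_W/2`): for `0 ≤ β_W < 1/6`,
`AreaLawOnBall 2 4 (β_W/2) (2ε) ε r mv` with `ε = (1 − 6β_W)/(4(1 − 3β_W))` — hypothesis-free (inside rb-p2's sharper quarter-modulus radius
function; recorded for the all-`N` comparison only). [folklore] -/
theorem su2_areaLawOnBall_radius_bePair {βW : ℝ} (hβ : 0 ≤ βW) (hlt : βW < 1 / 6) (r : ℕ) {mv : ℕ} (hmv : 1 ≤ mv) :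
    AreaLawOnBall 2 4 (βW / 2) (2 * ((1 - 6 * βW) / (4 * (1 - 3 * βW)))) ((1 - 6 * βW) / (4 * (1 - 3 * βW))) r mv := by
  have habs : |βW / 4| * (2 * ((3 : ℕ) : ℝ)) = 3 * βW / 2 := by rw [abs_of_nonneg (by positivity)]; push_cast; ring
  have h := suN_areaLawOnBall_radius (N := 2) (n := 3) le_rfl (βt := βW / 4) (by rw [habs]; linarith) r hmv
  rw [habs] at h
  have e1 : ((2 : ℕ) : ℝ) * (βW / 4) = βW / 2 := by push_cast; ring
  have e2 : (1 - 4 * (3 * βW / 2)) / (4 * (1 - 2 * (3 * βW / 2))) = (1 - 6 * βW) / (4 * (1 - 3 * βW)) := by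
    congr 1 <;> ring
  rw [e1, e2] at h
  exact h

/-- The `SU(3)`, `d = 4` reading in Wilson units (`β_tH = β_W/9`, `R = 2β_W/3`): for `0 ≤ β_W < 3/8` (the Bakry–Émery window of the door),
`AreaLawOnBall 3 4 (β_W/3) (2ε) ε r mv` with `ε = (3 − 8β_W)/(4(3 − 4β_W))` — HYPOTHESIS-FREE, positive at every coupling of the window
(grid cells of `AreaLawRowsSU3FreePair` are larger: `(1/8, .407)`, `(1/4, .203)`, `(1/3, .069)` against `.2`, `.125`, `.05` here). [folklore] -/
theorem su3_areaLawOnBall_radius_bePair {βW : ℝ} (hβ : 0 ≤ βW) (hlt : βW < 3 / 8) (r : ℕ) {mv : ℕ} (hmv : 1 ≤ mv) :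
    AreaLawOnBall 3 4 (βW / 3) (2 * ((3 - 8 * βW) / (4 * (3 - 4 * βW)))) ((3 - 8 * βW) / (4 * (3 - 4 * βW))) r mv := by
  have habs : |βW / 9| * (2 * ((3 : ℕ) : ℝ)) = 2 * βW / 3 := by rw [abs_of_nonneg (by positivity)]; push_cast; ring
  have h := suN_areaLawOnBall_radius (N := 3) (n := 3) (by norm_num) (βt := βW / 9) (by rw [habs]; linarith) r hmv
  rw [habs] at h
  have e1 : ((3 : ℕ) : ℝ) * (βW / 9) = βW / 3 := by push_cast; ring
  have e2 : (1 - 4 * (2 * βW / 3)) / (4 * (1 - 2 * (2 * βW / 3))) = (3 - 8 * βW) / (4 * (3 - 4 * βW)) := by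
    rw [div_eq_div_iff (by linarith) (by linarith)]; ring
  rw [e1, e2] at h
  exact h

/-! ### 2. `SU(3)`, `d = 4`: the certified-pair rows on whole coupling intervals -/

/-- The pair-door certificate is monotone in the coupling: for `0 ≤ β ≤ β'`, `0 ≤ a`, `0 ≤ T₂`,
`T₂(aβ) + t ≤ T₂(aβ') + t`. [folklore] -/
theorem cert_mono {T₂ a β β' t : ℝ} (hT : 0 ≤ T₂) (ha : 0 ≤ a) (hβ : β ≤ β') :
    T₂ * (a * β) + t ≤ T₂ * (a * β') + t := by
  have : a * β ≤ a * β' := mul_le_mul_of_nonneg_left hβ ha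
  nlinarith

/-- **`SU(3)`, `d = 4`, GIVEN H1, H2: radius `0.381` on the whole interval `0 ≤ β_W ≤ 1/4`** — `AreaLawOnBall 3 4 (β_W/3) 0.762 0.381 r mv`
(the grid row `su3_hsRow4_1_4` read on the interval; the certificate is monotone in `β_W`). [folklore] -/
theorem su3_hsRow4_upTo_1_4 (hP : OneLinkPoincareSUN 3 (3 / 5) (4 / 5)) (hV : OneLinkVarianceBound 3 (11 / 30) (49 / 20))
    {βW : ℝ} (hβ0 : 0 ≤ βW) (hβ : βW ≤ 1 / 4) (r : ℕ) {mv : ℕ} (hmv : 1 ≤ mv) :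
    AreaLawOnBall 3 4 (βW / 3) (2 * (381 / 1000)) (381 / 1000) r mv :=
  su3_hsRow4 r hmv hP hV hβ0 (by linarith) (by norm_num) (by norm_num)
    (lt_of_le_of_lt (cert_mono (by norm_num) (by norm_num) hβ) (by norm_num))

/-- **`SU(3)`, `d = 4`, GIVEN H1, H2: radius `0.230` on the whole interval `0 ≤ β_W ≤ 1/2`.** [folklore] -/
theorem su3_hsRow4_upTo_1_2 (hP : OneLinkPoincareSUN 3 (3 / 5) (4 / 5)) (hV : OneLinkVarianceBound 3 (11 / 30) (49 / 20))
    {βW : ℝ} (hβ0 : 0 ≤ βW) (hβ : βW ≤ 1 / 2) (r : ℕ) {mv : ℕ} (hmv : 1 ≤ mv) :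
    AreaLawOnBall 3 4 (βW / 3) (2 * (23 / 100)) (23 / 100) r mv :=
  su3_hsRow4 r hmv hP hV hβ0 (by linarith) (by norm_num) (by norm_num)
    (lt_of_le_of_lt (cert_mono (by norm_num) (by norm_num) hβ) (by norm_num))

/-- **`SU(3)`, `d = 4`, GIVEN H1, H2: radius `0.205` on the whole radius-capped range `0 ≤ β_W ≤ 11/20` of P11** — the `SU(3)` area-law ball has
radius at least `0.205` at EVERY Wilson coupling up to `11/20`. [folklore] -/
theorem su3_hsRow4_upTo_11_20 (hP : OneLinkPoincareSUN 3 (3 / 5) (4 / 5)) (hV : OneLinkVarianceBound 3 (11 / 30) (49 / 20))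
    {βW : ℝ} (hβ0 : 0 ≤ βW) (hβ : βW ≤ 11 / 20) (r : ℕ) {mv : ℕ} (hmv : 1 ≤ mv) :
    AreaLawOnBall 3 4 (βW / 3) (2 * (41 / 200)) (41 / 200) r mv :=
  su3_hsRow4 r hmv hP hV hβ0 hβ (by norm_num) (by norm_num)
    (lt_of_le_of_lt (cert_mono (by norm_num) (by norm_num) hβ) (by norm_num))

/-- **`SU(3)`, `d = 4`, GIVEN H1, H2′: radius `0.064` on the whole interval `0 ≤ β_W ≤ 3/4`** (P35 row `su3_hsRow4_3_4` on the interval). [folklore] -/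
theorem su3_hsRow4'_upTo_3_4 (hP : OneLinkPoincareSUN 3 (3 / 5) (4 / 5)) (hV : OneLinkVarianceBound 3 (3 / 5) (17 / 5))
    {βW : ℝ} (hβ0 : 0 ≤ βW) (hβ : βW ≤ 3 / 4) (r : ℕ) {mv : ℕ} (hmv : 1 ≤ mv) :
    AreaLawOnBall 3 4 (βW / 3) (2 * (8 / 125)) (8 / 125) r mv :=
  su3_hsRow4' r hmv hP hV hβ0 (by linarith) (by norm_num) (by norm_num)
    (lt_of_le_of_lt (cert_mono (by norm_num) (by norm_num) hβ) (by norm_num))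

/-- **`SU(3)`, `d = 4`, GIVEN H1, H2′: radius `0.043` on the whole interval `0 ≤ β_W ≤ 4/5`.** [folklore] -/
theorem su3_hsRow4'_upTo_4_5 (hP : OneLinkPoincareSUN 3 (3 / 5) (4 / 5)) (hV : OneLinkVarianceBound 3 (3 / 5) (17 / 5))
    {βW : ℝ} (hβ0 : 0 ≤ βW) (hβ : βW ≤ 4 / 5) (r : ℕ) {mv : ℕ} (hmv : 1 ≤ mv) :
    AreaLawOnBall 3 4 (βW / 3) (2 * (43 / 1000)) (43 / 1000) r mv :=
  su3_hsRow4' r hmv hP hV hβ0 (by linarith) (by norm_num) (by norm_num)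
    (lt_of_le_of_lt (cert_mono (by norm_num) (by norm_num) hβ) (by norm_num))


/-! ### 3. `SU(3)`: AFFINE radius functions on the whole coupling ranges of the certified pairs (pair door; Positivstellensatz certificates)

On each radius-capped range the one-parameter pair-door certificate `T(2ε)c_W(β_W) + T(ε)·0.8945·ε < 1` holds for an AFFINE radius
`ε(β_W)` fitted under the convex envelope of the grid rows; the degree-5 polynomial inequality in `β_W` is discharged by `nlinarith` with the
products `β_W^k (β⋆ − β_W) ≥ 0` as hints (maxima: `0.9706` on P11, `0.9911` on P35, both `d = 4` and `d = 3`).  These supersede the step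
functions of §2: GIVEN H1/H2, `ε(β_W) = 0.47 − β_W/2` for all `0 ≤ β_W ≤ 11/20` (`d = 4`; values `.47, .345, .22, .195` at `0, 1/4, 1/2, 11/20`,
under the grid cells `.64, .381, .230, .205`) and `0.47 − β_W/3` for `0 ≤ β_W ≤ 33/40` (`d = 3`); GIVEN H1/H2′, `ε(β_W) = 0.36 − 0.4β_W` for all
`0 ≤ β_W ≤ 9/10` (`d = 4`; LINEAR VANISHING at `β_W = 9/10`, the radius cap of P35, where the pure Wilson door value is `0.98958`) and
`0.36 − (4/15)β_W` for `0 ≤ β_W ≤ 27/20` (`d = 3`). -/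

/-- **`SU(3)`, `d = 4`, GIVEN H1, H2: AFFINE AREA-LAW RADIUS `ε(β_W) = 0.47 − β_W/2` on the whole range `0 ≤ β_W ≤ 11/20`** —
`AreaLawOnBall 3 4 (β_W/3) (2ε(β_W)) ε(β_W) r mv` for every range `r` and window `mv ≥ 1` (pair door on P11; certificate by `nlinarith`). [folklore] -/
theorem su3_areaLawOnBall_affineRadius (hP : OneLinkPoincareSUN 3 (3 / 5) (4 / 5)) (hV : OneLinkVarianceBound 3 (11 / 30) (49 / 20))
    {βW : ℝ} (hβ0 : 0 ≤ βW) (hβ : βW ≤ 11 / 20) (r : ℕ) {mv : ℕ} (hmv : 1 ≤ mv) :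
    AreaLawOnBall 3 4 (βW / 3) (2 * (47 / 100 - βW / 2)) (47 / 100 - βW / 2) r mv :=
  su3_hsRow4 r hmv hP hV hβ0 hβ (by linarith) (by linarith)
    (by nlinarith [mul_nonneg hβ0 (sub_nonneg.2 hβ), pow_nonneg hβ0 2, pow_nonneg hβ0 3, mul_nonneg (pow_nonneg hβ0 2) (sub_nonneg.2 hβ),
      mul_nonneg (pow_nonneg hβ0 3) (sub_nonneg.2 hβ), pow_nonneg hβ0 4, mul_nonneg (pow_nonneg hβ0 4) (sub_nonneg.2 hβ)])

/-- **`SU(3)`, `d = 4`, GIVEN H1, H2′: AFFINE AREA-LAW RADIUS `ε(β_W) = 0.36 − 0.4 β_W` on the whole range `0 ≤ β_W ≤ 9/10`** (pair door on P35),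
vanishing linearly at the radius cap `β_W = 9/10`: `AreaLawOnBall 3 4 (β_W/3) (2ε(β_W)) ε(β_W) r mv`. [folklore] -/
theorem su3_areaLawOnBall_affineRadius' (hP : OneLinkPoincareSUN 3 (3 / 5) (4 / 5)) (hV : OneLinkVarianceBound 3 (3 / 5) (17 / 5))
    {βW : ℝ} (hβ0 : 0 ≤ βW) (hβ : βW ≤ 9 / 10) (r : ℕ) {mv : ℕ} (hmv : 1 ≤ mv) :
    AreaLawOnBall 3 4 (βW / 3) (2 * (9 / 25 - 2 / 5 * βW)) (9 / 25 - 2 / 5 * βW) r mv :=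
  su3_hsRow4' r hmv hP hV hβ0 hβ (by linarith) (by linarith)
    (by nlinarith [mul_nonneg hβ0 (sub_nonneg.2 hβ), pow_nonneg hβ0 2, pow_nonneg hβ0 3, mul_nonneg (pow_nonneg hβ0 2) (sub_nonneg.2 hβ),
      mul_nonneg (pow_nonneg hβ0 3) (sub_nonneg.2 hβ), pow_nonneg hβ0 4, mul_nonneg (pow_nonneg hβ0 4) (sub_nonneg.2 hβ)])

/-- **`SU(3)`, `d = 3`, GIVEN H1, H2: AFFINE RADIUS `ε(β_W) = 0.47 − β_W/3` on `0 ≤ β_W ≤ 33/40`**: `AreaLawOnBall 3 3 (β_W/3) (2ε(β_W)) ε(β_W) r mv`.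
[folklore] -/
theorem su3_areaLawOnBall_dim3_affineRadius (hP : OneLinkPoincareSUN 3 (3 / 5) (4 / 5))
    (hV : OneLinkVarianceBound 3 (11 / 30) (49 / 20)) {βW : ℝ} (hβ0 : 0 ≤ βW) (hβ : βW ≤ 33 / 40) (r : ℕ) {mv : ℕ} (hmv : 1 ≤ mv) :
    AreaLawOnBall 3 3 (βW / 3) (2 * (47 / 100 - βW / 3)) (47 / 100 - βW / 3) r mv :=
  su3_hsRow3 r hmv hP hV hβ0 hβ (by linarith) (by linarith)
    (by nlinarith [mul_nonneg hβ0 (sub_nonneg.2 hβ), pow_nonneg hβ0 2, pow_nonneg hβ0 3, mul_nonneg (pow_nonneg hβ0 2) (sub_nonneg.2 hβ),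
      mul_nonneg (pow_nonneg hβ0 3) (sub_nonneg.2 hβ), pow_nonneg hβ0 4, mul_nonneg (pow_nonneg hβ0 4) (sub_nonneg.2 hβ)])

/-- **`SU(3)`, `d = 3`, GIVEN H1, H2′: AFFINE RADIUS `ε(β_W) = 0.36 − (4/15)β_W` on `0 ≤ β_W ≤ 27/20`** (vanishing at the radius cap `27/20`):
`AreaLawOnBall 3 3 (β_W/3) (2ε(β_W)) ε(β_W) r mv`. [folklore] -/
theorem su3_areaLawOnBall_dim3_affineRadius' (hP : OneLinkPoincareSUN 3 (3 / 5) (4 / 5))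
    (hV : OneLinkVarianceBound 3 (3 / 5) (17 / 5)) {βW : ℝ} (hβ0 : 0 ≤ βW) (hβ : βW ≤ 27 / 20) (r : ℕ) {mv : ℕ} (hmv : 1 ≤ mv) :
    AreaLawOnBall 3 3 (βW / 3) (2 * (9 / 25 - 4 / 15 * βW)) (9 / 25 - 4 / 15 * βW) r mv :=
  su3_hsRow3' r hmv hP hV hβ0 hβ (by linarith) (by linarith)
    (by nlinarith [mul_nonneg hβ0 (sub_nonneg.2 hβ), pow_nonneg hβ0 2, pow_nonneg hβ0 3, mul_nonneg (pow_nonneg hβ0 2) (sub_nonneg.2 hβ),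
      mul_nonneg (pow_nonneg hβ0 3) (sub_nonneg.2 hβ), pow_nonneg hβ0 4, mul_nonneg (pow_nonneg hβ0 4) (sub_nonneg.2 hβ)])

end Summit.Ventures.YMGap.RobustBallPair

end
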